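import Mathlib
import HarnessLib
import Literature.Analysis.FluidPDE.Tao2016AveragedNS.TaylorChainCertificate
import Summits.NavierStokesRegularity.NavierStokesRegularity.Theorems.TaylorModelRungThreeReadoutG3Base

/-!
# Line `taylor-model` on crux K1b-DR (stmt-NavierStokesRegularity-23954) — stub G3 (`stub_tube : TubeLip`),
# helper file 4: three calculus lemmas for the LIP half

Generic one-variable calculus over the window balls `cd.InBall j` of a certificate (namespace
`…TaylorModelReadout.G3`), used to differentiate the flow of an abstract flow package ACROSS the nodes of the
chain, where the segment-derivative clause (F4) of `IsFlowPackage` only gives derivatives along straight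
segments inside one majorant horizon:

* `hasDerivWithinAt_comp_curve` — CHAIN RULE ALONG A C¹ CURVE for a scalar map `g` of window states that is
  Lipschitz (in the weighted window sup-distance) near a point `p` and has a two-sided directional derivative
  at `p` along the curve's velocity `η`: then `g ∘ γ` is differentiable there with the same value (the
  Hadamard-type argument `g(γ σ) − g(p + (σ−σ₀)η) = O(Lip) · o(σ − σ₀)`); no linearity of the directional
  derivative in `η` is needed;
* `hasDerivAt_dir_of_segment` — the two-sided directional derivative at `p` along `η` from the segment clause
  between `p − ε η` and `p + ε η` read at the midpoint (affine reparametrisation);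
* `abs_le_of_hasDerivWithinAt_Icc` — a derivative within `[0,1]` is bounded by a local Lipschitz constant
  (slopes; both endpoints included).

MODEL-lattice bookkeeping only (rung TL-M3 of the NS ladder); nothing here is a statement about the
Navier–Stokes equations.
-/

noncomputable section

-- the sub-problem namespace repeats the summit name by design (D-0017)
set_option linter.dupNamespace false

namespace Summit.NavierStokesRegularity.NavierStokesRegularity.Theorems.TaylorModelReadout.G3

open Set Filter Topology Asymptotics
open Literature.Analysis.FluidPDE.TaoCascade Literature.Analysis.FluidPDE.TaoCascade.TaylorChain
open Summit.NavierStokesRegularity.NavierStokesRegularity.Theorems.TaylorModelReadout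

variable {cd : CertData} {j : ℕ}

/-- **Chain rule along a C¹ curve** for a map that is Lipschitz near the point (weighted window distance)
and has a two-sided directional derivative there along the velocity of the curve. [folklore] -/
theorem hasDerivWithinAt_comp_curve (hω : ∀ k, 0 < cd.ω j k)
    {g : (Fin 4 → ℤ → ℝ) → ℝ} {p η : Fin 4 → ℤ → ℝ} {γ : ℝ → (Fin 4 → ℤ → ℝ)} {s : Set ℝ}
    {σ₀ a ρ₀ C : ℝ} (hρ₀ : 0 < ρ₀)
    (hLip : ∀ y y' : Fin 4 → ℤ → ℝ, cd.InBall j (y - p) ρ₀ → cd.InBall j (y' - p) ρ₀ →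
      ∀ r : ℝ, cd.InBall j (y - y') r → |g y - g y'| ≤ C * r)
    (hDir : HasDerivAt (fun θ : ℝ => g (p + θ • η)) a 0)
    (hγ₀ : ∀ i k, -cd.Kb ≤ k → k ≤ cd.Ka → γ σ₀ i k = p i k)
    (hγ : ∀ i k, -cd.Kb ≤ k → k ≤ cd.Ka → HasDerivWithinAt (fun σ => γ σ i k) (η i k) s σ₀) :
    HasDerivWithinAt (fun σ => g (γ σ)) a s σ₀ := by
  classical
  -- the window as a finite index set, and a weighted size of η on it
  set W : Finset (Fin 4 × ℤ) := Finset.univ ×ˢ Finset.Icc (-cd.Kb) cd.Ka with hW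
  have hmemW : ∀ i k, -cd.Kb ≤ k → k ≤ cd.Ka → (i, k) ∈ W := fun i k h1 h2 => by
    simp [hW, Finset.mem_product, Finset.mem_Icc, h1, h2]
  set Nη : ℝ := ∑ ik ∈ W, |η ik.1 ik.2| / cd.ω j ik.2 with hNη
  have hNη0 : 0 ≤ Nη := Finset.sum_nonneg fun ik _ => div_nonneg (abs_nonneg _) (hω _).le
  have hηN : cd.InBall j η Nη := by
    intro i k hk1 hk2
    have h1 : |η i k| / cd.ω j k ≤ Nη :=
      Finset.single_le_sum (f := fun ik : Fin 4 × ℤ => |η ik.1 ik.2| / cd.ω j ik.2)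
        (fun ik _ => div_nonneg (abs_nonneg _) (hω _).le) (hmemW i k hk1 hk2)
    rwa [div_le_iff₀ (hω k)] at h1
  -- g p = g (γ σ₀)
  have hγσ₀ : cd.InBall j (γ σ₀ - p) 0 := fun i k hk1 hk2 => by simp [hγ₀ i k hk1 hk2]
  have hgp : g (γ σ₀) = g p := by
    have h := hLip (γ σ₀) p (inBall_mono hω hγσ₀ hρ₀.le)
      (by rw [sub_self]; exact inBall_zero hω hρ₀.le) 0 hγσ₀
    rw [mul_zero, abs_nonpos_iff, sub_eq_zero] at h
    exact h
  -- σ - σ₀ → 0 within s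
  have hT : Tendsto (fun σ : ℝ => σ - σ₀) (𝓝[s] σ₀) (𝓝 0) := by
    have h : Tendsto (fun σ : ℝ => σ - σ₀) (𝓝 σ₀) (𝓝 (σ₀ - σ₀)) := tendsto_id.sub tendsto_const_nhds
    rw [sub_self] at h
    exact h.mono_left nhdsWithin_le_nhds
  -- the directional part
  have hD : (fun σ => g (p + (σ - σ₀) • η) - g p - (σ - σ₀) • a) =o[𝓝[s] σ₀] fun σ => σ - σ₀ := by
    have h1 := (hasDerivAt_iff_isLittleO.mp hDir).comp_tendsto hT
    simpa [Function.comp_def] using h1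
  -- the curve part
  have hE : (fun σ => g (γ σ) - g (p + (σ - σ₀) • η)) =o[𝓝[s] σ₀] fun σ => σ - σ₀ := by
    rw [Asymptotics.isLittleO_iff]
    intro c hc
    set c' : ℝ := c / (|C| + 1) with hc'
    have hc'pos : 0 < c' := div_pos hc (by positivity)
    have hcomp : ∀ ik ∈ W, ∀ᶠ σ in 𝓝[s] σ₀,
        |γ σ ik.1 ik.2 - γ σ₀ ik.1 ik.2 - (σ - σ₀) * η ik.1 ik.2| ≤ c' * cd.ω j ik.2 * |σ - σ₀| := by
      intro ik hik
      have hk : -cd.Kb ≤ ik.2 ∧ ik.2 ≤ cd.Ka := by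
        simpa [hW, Finset.mem_product, Finset.mem_Icc] using hik
      have h1 := hasDerivWithinAt_iff_isLittleO.mp (hγ ik.1 ik.2 hk.1 hk.2)
      rw [Asymptotics.isLittleO_iff] at h1
      have h2 := h1 (c := c' * cd.ω j ik.2) (mul_pos hc'pos (hω _))
      refine h2.mono fun σ hσ => ?_
      simpa only [Real.norm_eq_abs, smul_eq_mul] using hσ
    have hall := (Filter.eventually_all_finset W).mpr hcomp
    set δ₀ : ℝ := ρ₀ / (Nη + c' + 1) with hδ₀
    have hden : 0 < Nη + c' + 1 := by positivity
    have hδ₀pos : 0 < δ₀ := div_pos hρ₀ hden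
    have hδ₀eq : δ₀ * (Nη + c' + 1) = ρ₀ := div_mul_cancel₀ _ hden.ne'
    have hsmall : ∀ᶠ σ in 𝓝[s] σ₀, |σ - σ₀| ≤ δ₀ := by
      have h := (Metric.tendsto_nhds.mp hT) δ₀ hδ₀pos
      refine h.mono fun σ hσ => ?_
      rw [Real.dist_eq, sub_zero] at hσ
      exact hσ.le
    filter_upwards [hall, hsmall] with σ hσ hσs
    have hB1 : cd.InBall j (γ σ - (p + (σ - σ₀) • η)) (c' * |σ - σ₀|) := by
      intro i k hk1 hk2
      have h := hσ (i, k) (hmemW i k hk1 hk2)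
      simp only at h
      simp only [Pi.sub_apply, Pi.add_apply, Pi.smul_apply, smul_eq_mul]
      rw [← hγ₀ i k hk1 hk2]
      calc |γ σ i k - (γ σ₀ i k + (σ - σ₀) * η i k)|
          = |γ σ i k - γ σ₀ i k - (σ - σ₀) * η i k| := by ring_nf
        _ ≤ c' * cd.ω j k * |σ - σ₀| := h
        _ = c' * |σ - σ₀| * cd.ω j k := by ring
    have hB2' : cd.InBall j ((σ - σ₀) • η) (|σ - σ₀| * Nη) := inBall_smul _ hηN
    have hB2 : cd.InBall j ((p + (σ - σ₀) • η) - p) ρ₀ := by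
      rw [add_sub_cancel_left]
      refine inBall_mono hω hB2' ?_
      calc |σ - σ₀| * Nη ≤ δ₀ * Nη := mul_le_mul_of_nonneg_right hσs hNη0
        _ ≤ δ₀ * (Nη + c' + 1) := mul_le_mul_of_nonneg_left (by linarith) hδ₀pos.le
        _ = ρ₀ := hδ₀eq
    have hB3 : cd.InBall j (γ σ - p) ρ₀ := by
      have e : γ σ - p = (γ σ - (p + (σ - σ₀) • η)) + (σ - σ₀) • η := by abel
      rw [e]
      refine inBall_mono hω (inBall_add hB1 hB2') ?_
      calc c' * |σ - σ₀| + |σ - σ₀| * Nη = |σ - σ₀| * (Nη + c') := by ring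
        _ ≤ δ₀ * (Nη + c') := mul_le_mul_of_nonneg_right hσs (by linarith)
        _ ≤ δ₀ * (Nη + c' + 1) := mul_le_mul_of_nonneg_left (by linarith) hδ₀pos.le
        _ = ρ₀ := hδ₀eq
    have h := hLip _ _ hB3 hB2 _ hB1
    have hCc : |C| * c' ≤ c := by
      rw [hc', mul_div_assoc', div_le_iff₀ (by positivity)]
      nlinarith [abs_nonneg C]
    calc ‖g (γ σ) - g (p + (σ - σ₀) • η)‖ = |g (γ σ) - g (p + (σ - σ₀) • η)| := Real.norm_eq_abs _
      _ ≤ C * (c' * |σ - σ₀|) := h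
      _ ≤ |C| * (c' * |σ - σ₀|) := mul_le_mul_of_nonneg_right (le_abs_self C) (by positivity)
      _ = (|C| * c') * |σ - σ₀| := by ring
      _ ≤ c * |σ - σ₀| := mul_le_mul_of_nonneg_right hCc (abs_nonneg _)
      _ = c * ‖σ - σ₀‖ := by rw [Real.norm_eq_abs]
  rw [hasDerivWithinAt_iff_isLittleO]
  exact (hE.add hD).congr (fun σ => by rw [hgp]; ring) (fun _ => rfl)

/-- From the segment clause between `p − ε•η` and `p + ε•η`, read at the midpoint `σ' = 1/2`, to the
two-sided directional derivative at `p` along `η` (affine reparametrisation `θ = 2ε(σ' − 1/2)`). [folklore] -/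
theorem hasDerivAt_dir_of_segment {g : (Fin 4 → ℤ → ℝ) → ℝ} {p η : Fin 4 → ℤ → ℝ} {ε b : ℝ}
    (hε : 0 < ε)
    (h : HasDerivWithinAt (fun σ' : ℝ => g ((p - ε • η) + σ' • ((p + ε • η) - (p - ε • η)))) b
      (Icc 0 1) (1 / 2)) :
    HasDerivAt (fun θ : ℝ => g (p + θ • η)) (b / (2 * ε)) 0 := by
  have h1 : HasDerivAt (fun σ' : ℝ => g ((p - ε • η) + σ' • ((p + ε • η) - (p - ε • η)))) b
      ((fun θ : ℝ => θ / (2 * ε) + 1 / 2) 0) := by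
    have h0 : (fun θ : ℝ => θ / (2 * ε) + 1 / 2) 0 = 1 / 2 := by simp
    rw [h0]
    exact h.hasDerivAt (Icc_mem_nhds (by norm_num) (by norm_num))
  have h2 : HasDerivAt (fun θ : ℝ => θ / (2 * ε) + 1 / 2) (1 / (2 * ε)) 0 := by
    simpa using ((hasDerivAt_id (0:ℝ)).div_const (2 * ε)).add_const (1 / 2 : ℝ)
  have h3 := h1.comp 0 h2
  have hfun : ((fun σ' : ℝ => g ((p - ε • η) + σ' • ((p + ε • η) - (p - ε • η)))) ∘
      fun θ : ℝ => θ / (2 * ε) + 1 / 2) = fun θ : ℝ => g (p + θ • η) := by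
    funext θ
    simp only [Function.comp_apply]
    congr 1
    funext i k
    simp only [Pi.add_apply, Pi.sub_apply, Pi.smul_apply, smul_eq_mul]
    field_simp
    ring
  rw [hfun] at h3
  refine h3.congr_deriv ?_
  field_simp

/-- A derivative within `[0,1]` is bounded by a LOCAL Lipschitz constant at the point (slopes from inside the
interval; endpoints included). [folklore] -/
theorem abs_le_of_hasDerivWithinAt_Icc {f : ℝ → ℝ} {a σ₀ L r₀ : ℝ} (hσ₀ : σ₀ ∈ Icc (0:ℝ) 1)
    (hr₀ : 0 < r₀) (hf : HasDerivWithinAt f a (Icc 0 1) σ₀)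
    (hL : ∀ σ ∈ Icc (0:ℝ) 1, |σ - σ₀| ≤ r₀ → |f σ - f σ₀| ≤ L * |σ - σ₀|) : |a| ≤ L := by
  rw [hasDerivWithinAt_iff_tendsto_slope] at hf
  haveI : (𝓝[Icc (0:ℝ) 1 \ {σ₀}] σ₀).NeBot := by
    rcases eq_or_lt_of_le hσ₀.2 with h1 | h1
    · rw [h1]
      exact (right_nhdsWithin_Ioo_neBot (zero_lt_one' ℝ)).mono
        (nhdsWithin_mono _ fun x hx => ⟨⟨hx.1.le, hx.2.le⟩, ne_of_lt hx.2⟩)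
    · exact (left_nhdsWithin_Ioo_neBot h1).mono
        (nhdsWithin_mono _ fun x hx => ⟨⟨hσ₀.1.trans hx.1.le, hx.2.le⟩, fun h => (ne_of_gt hx.1) h⟩)
  have hev : ∀ᶠ σ in 𝓝[Icc (0:ℝ) 1 \ {σ₀}] σ₀, |slope f σ₀ σ| ≤ L := by
    have h1 : ∀ᶠ σ in 𝓝[Icc (0:ℝ) 1 \ {σ₀}] σ₀, σ ∈ Icc (0:ℝ) 1 \ {σ₀} := self_mem_nhdsWithin
    have h2 : ∀ᶠ σ in 𝓝[Icc (0:ℝ) 1 \ {σ₀}] σ₀, |σ - σ₀| < r₀ := by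
      filter_upwards [mem_nhdsWithin_of_mem_nhds (Metric.ball_mem_nhds σ₀ hr₀)] with σ hσ
      rwa [Metric.mem_ball, Real.dist_eq] at hσ
    filter_upwards [h1, h2] with σ hσ1 hσ2
    have hne : σ - σ₀ ≠ 0 := sub_ne_zero.mpr hσ1.2
    have hb := hL σ hσ1.1 hσ2.le
    rw [slope_def_field, abs_div, div_le_iff₀ (abs_pos.mpr hne)]
    exact hb
  exact le_of_tendsto ((continuous_abs.tendsto a).comp hf) hev

end Summit.NavierStokesRegularity.NavierStokesRegularity.Theorems.TaylorModelReadout.G3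

end
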